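import Literature.MathematicalPhysics.QuantumFieldTheory.King1986.CompositionRate
import HarnessLib

/-!
# King 1986, (4.5)/(4.12): the composition law of the block-averaging effective Laplacian, PROVED,
# and Lemma 4.3 (4.18) = Prop. 3.10 (3.91) for the level symbols themselves

**Citation header (reproduction of PUBLISHED work; template file of the Bałaban lattice Yang–Mills
cell `pub-balaban`, TEMPLATE.md §18.6).**
C. King, *The U(1) Higgs model. I. The continuum limit*, Commun. Math. Phys. **102** (1986) 649–677
[King1986], §4 pp. 670–672.  Page images read: `b2b-balaban-template/king-renders/…-p022-x2.png`
(p. 670: (4.2)–(4.6)), `…-p023-x2.png` (p. 671: (4.7)–(4.16)), `…-p024-x2.png` (p. 672: (4.17)–(4.18)).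

**What King prints (verbatim).**  p. 670: "`u_k^η(p) = Π_{μ=1}^d [(e^{−ip_μ} − 1) η (e^{−iηp_μ} − 1)⁻¹]`,
(4.3) `Δ^η(p) = 4η⁻² Σ_{μ=1}^d sin²(1/2 ηp_μ) + m²(L^kε)²`, (4.4)
`Δ^{(k)}(p′) = (a_k⁻¹ + Σ_l |u_k^η(p′+l)|² Δ^η(p′+l)⁻¹)⁻¹`. (4.5)"; p. 671: "To prove convergence of
`Δ^{(k)}(p′)`, we notice that the composition law for renormalization transformations allows us to
write `Δ^{(k+n)}(p′)` in the form (4.6), with `D⁻¹(p) = a_n⁻¹L^{−2k} + Σ_{l′}|u_n^{η′}(p+l′)|²Δ^{η′}(p+l′)⁻¹`,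
(4.12) … `u_n^{η′}(p) = Π_{μ=1}^d [η⁻¹(e^{−iηp_μ} − 1) η′(e^{−iη′p_μ} − 1)]`. (4.13)" [sic: the print
omits the inverse on the last factor of (4.13); (4.3) has it and it is meant — cross-read G-pv05g4-3]; p. 672:
"Combining Lemmas 4.1 and 4.2 gives **Lemma 4.3.** `|Δ^{(k)}(p′) − Δ^{(k+n)}(p′)| ≤ CL^{−2k}Δ^{(k)}(p′)`.
(4.18)".  King STATES the composition law without proof; this file supplies it.

**What is proved here (everything PROVED; no named fact, no hypothesis beyond the printed ranges).**
In the cell's real Fourier vocabulary `Balaban1983to89.B4Strip` (`S1r`, `Sxir`, `uFactorr`, `Ur`,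
`DeltaXir`, `shiftr`; alias representatives `l_μ ∈ {0,…,N−1}`), with `N = L^k = η⁻¹`, `R = L^n`
(`η′ = (RN)⁻¹`), `M = m²(L^kε)² ≥ 0`, `p′ ∈ [−π,π]^d`:
* §1 one-coordinate identities: scaling `S_{(RN)⁻¹}(x) = N²·S_{R⁻¹}(x/N)`, `2π`- resp. `2πR`-periodicity
  of `S₁`, `S_{R⁻¹}`, non-vanishing of `S₁` off `2πℤ`, and the MULTIPLICATIVITY of the averaging weight
  (4.3)·(4.13): `uFactorr (R·N) (l + N·l′) x = uFactorr N l x · uFactorr R l′ ((x + 2πl)/N)` on `|x| ≤ π`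
  (`|u_{k+n}^{η′}(p′+l″)|² = |u_k^η(p′+l)|²·|u_n^{η′}(p′+l+l′)|²`, `l″ = l + L^k l′`);
* §2 the alias splitting `(Fin d → Fin R) × (Fin d → Fin N) ≃ (Fin d → Fin (R·N))`, `(l′,l) ↦ l + N·l′`
  coordinatewise, and **THE COMPOSITION LAW (4.5) = (4.6)∘(4.12)**:
  `composedInvResc (c_k + N⁻²c_n) (R·N) M p′ = c_k + Σ_l Ur N l p′ · composedInv c_n N R M (p′ + 2πl)`
  (`composition_law`; `c_k = a_k⁻¹`, `c_n = a_n⁻¹`, the constant `a_{k+n}⁻¹ = a_k⁻¹ + L^{−2k}a_n⁻¹` being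
  `EffectiveLaplacianRate.inv_aK_add`), i.e. the level-`(k+n)` symbol (4.5) built directly from the
  `η′`-lattice equals the level-`k` construction (4.6) applied to `D` of (4.12);
* §3 `2π`-PERIODICITY of the rescaled composed symbol in each coordinate away from the two points where
  `B4Strip.uFactorr`'s filled removable singularity sits (`composedInvResc_periodic`), whence the reduction
  of the cell's alias representatives `p′_μ + 2πl_μ ∈ [−π, 2πN−π]` to King's symmetric zone `|q_μ| ≤ πN`
  on which Lemma 4.2 (`CompositionRate.lemma42`) is stated;
* §4 `DeltaEff a N M p′ := (a⁻¹ + Σ_l Ur N l p′ · DeltaXir N M (p′+2πl)⁻¹)⁻¹` = (4.5) literally, and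
  **LEMMA 4.3 / PROP. 3.10 (3.91) FOR THE LEVEL SYMBOLS THEMSELVES, explicit constant, no structural
  hypothesis**: for `0 < a`, `0 < a_n`, `a′⁻¹ = a⁻¹ + N⁻²a_n⁻¹`, `N, R ≥ 1`, `M ≥ 0`, `p′ ≠ 0` in `[−π,π]^d`,
  `|DeltaEff a N M p′ − DeltaEff a′ (R·N) M p′| ≤ 2a(a_n⁻¹ + π²/48 + 1/3)·N⁻²·DeltaEff a N M p′`
  (`lemma43`), and the instance `a = a_k`, `a′ = a_{k+n}`, `N = L^k`, `R = L^n` (`lemma43_aK`):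
  "`|Δ^{(k)}(p′) − Δ^{(k+n)}(p′)| ≤ CL^{−2k}Δ^{(k)}(p′)`" with `C = 2a_k(a_n⁻¹ + π²/48 + 1/3)`.
This closes the one input that `CompositionRate.prop310_rate` left typed ("the structural composition
law", its docstring): the rate statement is now about King's operator (4.5) at two levels, with nothing
assumed.

SCOPE as in the sibling files: A = 0 background, scalar block averaging, free boundary conditions
(King p. 670 "and A = 0, of course"); King's paper is `d = 2, 3`, the statements hold for every `d`.
Nothing in this file refers to or asserts anything about Bałaban's papers; `B4Strip` supplies
definitions only.
-/

noncomputable section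

open Finset Real
open Literature.MathematicalPhysics.QuantumFieldTheory.Balaban1983to89

namespace Literature.MathematicalPhysics.QuantumFieldTheory.King1986

variable {dd : ℕ}

/-! ## §1 One-coordinate identities for the `B4Strip` symbols -/

-- `S_{n⁻¹}(z) = n²·S₁(z/n)` is definitional (`unfold B4Strip.Sxir B4Strip.S1r`); the tree already has it as
-- `Balaban1983to89.B5Prop11Fiber.Sxir_eq_sq_mul_S1r` (not imported: unrelated module), so it is inlined below.

/-- Scaling between the `η′ = (RN)⁻¹` and the `R⁻¹` symbols: `S_{(RN)⁻¹}(x) = N²·S_{R⁻¹}(x/N)`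
(rescaled form of "`Δ^{η′}(p+l′)`" in (4.12)). [cite: King1986, (4.4) p.670 and (4.12) p.671] -/
theorem Sxir_mul (R N : ℕ) (hN : N ≠ 0) (x : ℝ) :
    B4Strip.Sxir (R * N) x = (N : ℝ) ^ 2 * B4Strip.Sxir R (x / N) := by
  unfold B4Strip.Sxir
  have hN' : (N : ℝ) ≠ 0 := by exact_mod_cast hN
  have : x / ((R * N : ℕ) : ℝ) = x / N / R := by push_cast; rw [div_div, mul_comm]
  rw [this]; push_cast; ring

/-- `S₁` is `2π`-periodic: `S₁(z + 2πj) = S₁(z)`. [folklore] -/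
theorem S1r_add_two_pi_mul_nat (z : ℝ) (j : ℕ) :
    B4Strip.S1r (z + 2 * π * j) = B4Strip.S1r z := by
  unfold B4Strip.S1r
  rw [show z + 2 * π * j = z + j * (2 * π) by ring, Real.cos_add_nat_mul_two_pi]

/-- `S_{R⁻¹}` is `2πR`-periodic: `S_{R⁻¹}(z + 2πRj) = S_{R⁻¹}(z)`. [folklore] -/
theorem Sxir_add_two_pi_mul_nat {R : ℕ} (hR : R ≠ 0) (z : ℝ) (j : ℕ) :
    B4Strip.Sxir R (z + 2 * π * (R * j : ℕ)) = B4Strip.Sxir R z := by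
  unfold B4Strip.Sxir
  have hR' : (R : ℝ) ≠ 0 := by exact_mod_cast hR
  have : (z + 2 * π * ((R * j : ℕ) : ℝ)) / R = z / R + j * (2 * π) := by
    push_cast; field_simp
  rw [this, Real.cos_add_nat_mul_two_pi]

/-- `S₁(y) ≠ 0` for `y ≠ 0`, `|y| < 2π`. [folklore] -/
theorem S1r_ne_zero {y : ℝ} (hy0 : y ≠ 0) (hy : |y| < 2 * π) : B4Strip.S1r y ≠ 0 := by
  rw [B4Strip.S1r_eq]
  have h1 : -π < y / 2 := by have := (abs_lt.mp hy).1; linarith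
  have h2 : y / 2 < π := by have := (abs_lt.mp hy).2; linarith
  have hs : Real.sin (y / 2) ≠ 0 := by
    intro h
    have := (Real.sin_eq_zero_iff_of_lt_of_lt h1 h2).mp h
    exact hy0 (by linarith)
  positivity

/-- `S_{R⁻¹}(y) ≠ 0` for `y ≠ 0`, `|y| < 2πR`. [folklore] -/
theorem Sxir_ne_zero {R : ℕ} (hR : R ≠ 0) {y : ℝ} (hy0 : y ≠ 0) (hy : |y| < 2 * π * R) :
    B4Strip.Sxir R y ≠ 0 := by
  have hdef : B4Strip.Sxir R y = (R : ℝ) ^ 2 * B4Strip.S1r (y / R) := by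
    unfold B4Strip.Sxir B4Strip.S1r; ring
  rw [hdef]
  have hR' : (0 : ℝ) < R := by exact_mod_cast Nat.pos_of_ne_zero hR
  refine mul_ne_zero (by positivity) (S1r_ne_zero (div_ne_zero hy0 hR'.ne') ?_)
  rw [abs_div, Nat.abs_cast, div_lt_iff₀ hR']
  linarith

/-- The generic closed form of the averaging-weight factor: away from the filled removable singularity
(`k = 0 ∧ x = 0`), `uFactorr n k x = S₁(x)/S_{n⁻¹}(x + 2πk)`. [cite: Balaban1983RegularityDecay, (2.45) p.584] -/
theorem uFactorr_eq_div {n k : ℕ} {x : ℝ} (h : k ≠ 0 ∨ x ≠ 0) :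
    B4Strip.uFactorr n k x = B4Strip.S1r x / B4Strip.Sxir n (x + 2 * π * k) := by
  unfold B4Strip.uFactorr
  rcases h with hk | hx
  · simp [hk]
  · by_cases hk : k = 0
    · subst hk; simp [hx]
    · simp [hk]

/-- **Multiplicativity of the averaging weight** (4.3)·(4.13): for `|x| ≤ π`, `l < N`,
`|u_{k+n}^{η′}(x + 2π(l + N l′))|² = |u_k^η(x + 2πl)|² · |u_n^{η′}((x + 2πl) + 2πN l′)|²`, i.e. in the rescaled
`B4Strip` vocabulary `uFactorr (R·N) (l + N·l′) x = uFactorr N l x · uFactorr R l′ ((x+2πl)/N)`.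
[cite: King1986, (4.3) p.670 and (4.13) p.671] -/
theorem uFactorr_mul {N R : ℕ} (hN : 1 ≤ N) (hR : 1 ≤ R) {l : ℕ} (hl : l < N) (l' : ℕ) {x : ℝ}
    (hx : |x| ≤ π) :
    B4Strip.uFactorr (R * N) (l + N * l') x
      = B4Strip.uFactorr N l x * B4Strip.uFactorr R l' ((x + 2 * π * l) / N) := by
  have hN0 : N ≠ 0 := by omega
  have hR0 : R ≠ 0 := by omega
  have hN' : (0 : ℝ) < N := by exact_mod_cast Nat.pos_of_ne_zero hN0
  have hNR0 : R * N ≠ 0 := Nat.mul_ne_zero hR0 hN0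
  set y : ℝ := (x + 2 * π * l) / N with hydef
  by_cases hlx : l = 0 ∧ x = 0
  · -- the filled removable singularity: `x = 0`, `l = 0`
    obtain ⟨rfl, rfl⟩ := hlx
    have hy0 : y = 0 := by simp [hydef]
    by_cases hl' : l' = 0
    · subst hl'; simp [B4Strip.uFactorr, hy0]
    · -- both sides vanish: `S₁(0) = 0`
      have hS10 : B4Strip.S1r 0 = 0 := by simp [B4Strip.S1r]
      have hk : 0 + N * l' ≠ 0 := by simpa using Nat.mul_ne_zero hN0 hl'
      rw [uFactorr_eq_div (Or.inl hk), hS10, zero_div]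
      rw [hy0, uFactorr_eq_div (Or.inl hl'), hS10, zero_div, mul_zero]
  · -- generic case: all three factors are honest quotients
    have hlx' : l ≠ 0 ∨ x ≠ 0 := by tauto
    have hy_ne : y ≠ 0 := by
      rcases hlx' with hl0 | hx0
      · have hl1 : (1 : ℝ) ≤ l := by exact_mod_cast Nat.one_le_iff_ne_zero.mpr hl0
        have : 0 < x + 2 * π * l := by
          have := (abs_le.mp hx).1; nlinarith [Real.pi_pos]
        exact (div_pos this hN').ne'
      · by_cases hl0 : l = 0
        · subst hl0; simp [hydef]; exact ⟨hx0, hN0⟩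
        · have hl1 : (1 : ℝ) ≤ l := by exact_mod_cast Nat.one_le_iff_ne_zero.mpr hl0
          have : 0 < x + 2 * π * l := by
            have := (abs_le.mp hx).1; nlinarith [Real.pi_pos]
          exact (div_pos this hN').ne'
    have hy_lt : |y| < 2 * π := by
      rw [hydef, abs_div, Nat.abs_cast, div_lt_iff₀ hN']
      have hlN : (l : ℝ) ≤ N - 1 := by
        have : l + 1 ≤ N := hl
        have : ((l + 1 : ℕ) : ℝ) ≤ N := by exact_mod_cast this
        push_cast at this; linarith
      have h1 := (abs_le.mp hx).1
      have h2 := (abs_le.mp hx).2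
      rw [abs_lt]; constructor <;> nlinarith [Real.pi_pos]
    have hS1y : B4Strip.S1r y ≠ 0 := S1r_ne_zero hy_ne hy_lt
    have hk : l + N * l' ≠ 0 ∨ x ≠ 0 := by
      rcases hlx' with hl0 | hx0
      · left; omega
      · exact Or.inr hx0
    rw [uFactorr_eq_div hk, uFactorr_eq_div hlx']
    -- the inner factor at `y ≠ 0`: `uFactorr R l′ y = S₁(y)/S_{R⁻¹}(y + 2πl′)` in both branches
    have hinner : B4Strip.uFactorr R l' y = B4Strip.S1r y / B4Strip.Sxir R (y + 2 * π * l') :=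
      uFactorr_eq_div (Or.inr hy_ne)
    rw [hinner]
    -- `S_{N⁻¹}(x + 2πl) = N²·S₁(y)` and `S_{(RN)⁻¹}(x + 2π(l + N l′)) = N²·S_{R⁻¹}(y + 2πl′)`
    have h1 : B4Strip.Sxir N (x + 2 * π * l) = (N : ℝ) ^ 2 * B4Strip.S1r y := by
      rw [hydef]; unfold B4Strip.Sxir B4Strip.S1r; ring
    have h2 : B4Strip.Sxir (R * N) (x + 2 * π * ((l + N * l' : ℕ) : ℝ))
        = (N : ℝ) ^ 2 * B4Strip.Sxir R (y + 2 * π * l') := by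
      rw [Sxir_mul R N hN0]
      congr 2
      rw [hydef]; push_cast; field_simp; ring
    rw [h1, h2]
    by_cases hD : B4Strip.Sxir R (y + 2 * π * l') = 0
    · simp [hD]
    · field_simp

/-! ## §2 Alias splitting `l″ = l + N·l′` and the composition law (4.5) = (4.6)∘(4.12) -/

/-- The alias splitting `l″ = l + N·l′`: `(l′, l) ↦ (μ ↦ l_μ + N·l′_μ)` is a bijection
`(Fin d → Fin R) × (Fin d → Fin N) ≃ (Fin d → Fin (R·N))` (coordinatewise `finProdFinEquiv`).
[cite: King1986, (4.12) p.671 ("`l′ ∈ 2π(L^k)ℤ^d`")] -/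
def aliasSplit (dd R N : ℕ) : (Fin dd → Fin R) × (Fin dd → Fin N) ≃ (Fin dd → Fin (R * N)) where
  toFun x := fun μ => finProdFinEquiv (x.1 μ, x.2 μ)
  invFun l := (fun μ => (finProdFinEquiv.symm (l μ)).1, fun μ => (finProdFinEquiv.symm (l μ)).2)
  left_inv x := by
    ext μ <;> simp
  right_inv l := by
    funext μ
    simp only [Prod.mk.eta, Equiv.apply_symm_apply]

/-- The combined alias has value `l_μ + N·l′_μ`. [folklore] -/
theorem aliasSplit_apply_val (R N : ℕ) (l' : Fin dd → Fin R) (l : Fin dd → Fin N) (μ : Fin dd) :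
    ((aliasSplit dd R N (l', l) μ : Fin (R * N)) : ℕ) = (l μ : ℕ) + N * (l' μ : ℕ) := by
  simp [aliasSplit]

/-- Splitting an alias sum over `Fin d → Fin (R·N)` into the outer (`l`, level `k`) and inner
(`l′`, refinement) alias sums. [cite: King1986, (4.5)/(4.12) pp.670–671] -/
theorem sum_aliasSplit {R N : ℕ} (F : (Fin dd → Fin (R * N)) → ℝ) :
    ∑ l'' : Fin dd → Fin (R * N), F l''
      = ∑ l : Fin dd → Fin N, ∑ l' : Fin dd → Fin R, F (aliasSplit dd R N (l', l)) := by
  rw [Finset.sum_comm, ← Fintype.sum_prod_type', ← Equiv.sum_comp (aliasSplit dd R N) F]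

/-- Multiplicativity of the full weight: `|u_{k+n}(p′+l″)|² = |u_k(p′+l)|²·|u_n((p′+l)/…+l′)|²`, i.e.
`Ur (R·N) l″ p′ = Ur N l p′ · Ur R l′ ((p′ + 2πl)/N)` for `l″ = l + N·l′`, `p′ ∈ [−π,π]^d`.
[cite: King1986, (4.3) p.670, (4.13) p.671] -/
theorem Ur_mul {N R : ℕ} (hN : 1 ≤ N) (hR : 1 ≤ R) (l : Fin dd → Fin N) (l' : Fin dd → Fin R)
    {p : Fin dd → ℝ} (hp : ∀ μ, |p μ| ≤ π) :
    B4Strip.Ur (R * N) (aliasSplit dd R N (l', l)) p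
      = B4Strip.Ur N l p * B4Strip.Ur R l' (fun μ => B4Strip.shiftr N l p μ / N) := by
  unfold B4Strip.Ur
  rw [← Finset.prod_mul_distrib]
  refine Finset.prod_congr rfl fun μ _ => ?_
  rw [aliasSplit_apply_val, uFactorr_mul hN hR (l μ).isLt (l' μ) (hp μ)]
  rfl

/-- Scaling of the symbol at the combined alias: `Δ^{η′}(p′ + l″) = N²·DeltaXir R (M/N²) ((p′+l)/N + 2πl′)`
for `l″ = l + N·l′`. [cite: King1986, (4.4) p.670, (4.12) p.671] -/
theorem DeltaXir_mul {N R : ℕ} (hN : N ≠ 0) (M : ℝ) (l : Fin dd → Fin N) (l' : Fin dd → Fin R)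
    (p : Fin dd → ℝ) :
    B4Strip.DeltaXir (R * N) M (B4Strip.shiftr (R * N) (aliasSplit dd R N (l', l)) p)
      = (N : ℝ) ^ 2 * B4Strip.DeltaXir R (M / (N : ℝ) ^ 2)
          (B4Strip.shiftr R l' (fun μ => B4Strip.shiftr N l p μ / N)) := by
  have hN' : (N : ℝ) ≠ 0 := by exact_mod_cast hN
  unfold B4Strip.DeltaXir
  rw [mul_add, Finset.mul_sum, mul_div_cancel₀ _ (pow_ne_zero 2 hN')]
  congr 1
  refine Finset.sum_congr rfl fun μ _ => ?_
  simp only [B4Strip.shiftr]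
  rw [aliasSplit_apply_val, Sxir_mul R N hN]
  congr 2
  push_cast
  field_simp
  ring

/-- **THE COMPOSITION LAW (4.5) = (4.6)∘(4.12), PROVED.**  For `N, R ≥ 1` and `p′ ∈ [−π,π]^d`:
`c_k + N⁻²c_n + Σ_{l″ : Fin d → Fin (RN)} Ur (RN) l″ p′ · DeltaXir (RN) M (p′+2πl″)⁻¹`
`= c_k + Σ_{l : Fin d → Fin N} Ur N l p′ · composedInv c_n N R M (p′ + 2πl)`,
i.e. the inverse level-`(k+n)` symbol (4.5) over the `η′ = (RN)⁻¹` lattice equals the level-`k` form (4.6)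
with King's composed `D⁻¹` (4.12) in place of `Δ^η(·)⁻¹` (`c_k = a_k⁻¹`, `c_n = a_n⁻¹`; the Gaussian
constants combine by `EffectiveLaplacianRate.inv_aK_add`, the constant `N⁻²c_n` is distributed inside the
outer alias sum by the aliasing identity `Σ_l Ur N l p′ = 1`). [cite: King1986, (4.5)–(4.6) p.670, (4.12)–(4.13) p.671] -/
theorem composition_law {N R : ℕ} (hN : 1 ≤ N) (hR : 1 ≤ R) (cK cn M : ℝ) {p : Fin dd → ℝ}
    (hp : ∀ μ, |p μ| ≤ π) :
    composedInvResc (cK + ((N : ℝ) ^ 2)⁻¹ * cn) (R * N) M p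
      = cK + ∑ l : Fin dd → Fin N, B4Strip.Ur N l p * composedInv cn N R M (B4Strip.shiftr N l p) := by
  have hN0 : N ≠ 0 := by omega
  have hN' : (N : ℝ) ≠ 0 := by exact_mod_cast hN0
  have hN2 : ((N : ℝ) ^ 2) ≠ 0 := pow_ne_zero 2 hN'
  unfold composedInv composedInvResc
  -- distribute the outer weights over `c_n` and the inner alias sum
  have hsplit : ∀ l : Fin dd → Fin N,
      B4Strip.Ur N l p * (((N : ℝ) ^ 2)⁻¹ * (cn + ∑ l' : Fin dd → Fin R,
        B4Strip.Ur R l' (fun μ => B4Strip.shiftr N l p μ / N)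
          * (B4Strip.DeltaXir R (M / (N : ℝ) ^ 2)
              (B4Strip.shiftr R l' (fun μ => B4Strip.shiftr N l p μ / N)))⁻¹))
      = ((N : ℝ) ^ 2)⁻¹ * cn * B4Strip.Ur N l p
        + ∑ l' : Fin dd → Fin R, B4Strip.Ur (R * N) (aliasSplit dd R N (l', l)) p
            * (B4Strip.DeltaXir (R * N) M (B4Strip.shiftr (R * N) (aliasSplit dd R N (l', l)) p))⁻¹ := by
    intro l
    rw [mul_add, mul_add, Finset.mul_sum, Finset.mul_sum]
    congr 1
    · ring
    · refine Finset.sum_congr rfl fun l' _ => ?_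
      rw [Ur_mul hN hR l l' hp, DeltaXir_mul hN0 M l l' p, mul_inv]
      ring
  simp_rw [hsplit, Finset.sum_add_distrib, ← Finset.mul_sum, sum_Ur_eq_one hN hp, mul_one,
    sum_aliasSplit]
  ring

/-! ## §3 Periodicity of the composed symbol and reduction to King's symmetric zone -/

/-- One coordinate, weights: shifting the argument by `2πχ` is re-labelling the alias `l ↦ l + χ (mod R)`,
`uFactorr R l (y + 2πχ) = uFactorr R ((l+χ) mod R) y`, valid away from the two points where the filled
removable singularity of `B4Strip.uFactorr` sits (`y ≠ 0`, `y + 2πχ ≠ 0`), or trivially for `χ = 0`.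
[folklore] -/
theorem uFactorr_shift {R : ℕ} (hR : R ≠ 0) {l : ℕ} (hl : l < R) (χ : ℕ) {y : ℝ}
    (h : χ = 0 ∨ (y ≠ 0 ∧ y + 2 * π * χ ≠ 0)) :
    B4Strip.uFactorr R l (y + 2 * π * χ) = B4Strip.uFactorr R ((l + χ) % R) y := by
  rcases h with rfl | ⟨hy0, hyχ⟩
  · simp [Nat.mod_eq_of_lt hl]
  · set m : ℕ := l + χ with hm
    have hdec : ((m : ℕ) : ℝ) = ((m % R : ℕ) : ℝ) + ((R * (m / R) : ℕ) : ℝ) := by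
      exact_mod_cast (Nat.mod_add_div m R).symm
    -- left-hand side in closed form
    have hL : B4Strip.uFactorr R l (y + 2 * π * χ)
        = B4Strip.S1r y / B4Strip.Sxir R (y + 2 * π * (m : ℝ)) := by
      rw [uFactorr_eq_div (Or.inr hyχ), S1r_add_two_pi_mul_nat]
      congr 2; rw [hm]; push_cast; ring
    -- right-hand side in closed form
    have hRt : B4Strip.uFactorr R (m % R) y
        = B4Strip.S1r y / B4Strip.Sxir R (y + 2 * π * (m : ℝ)) := by
      by_cases hr0 : m % R = 0
      · rw [hr0, uFactorr_eq_div (Or.inr hy0), hdec, hr0, Nat.cast_zero, mul_zero, add_zero, zero_add,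
          Sxir_add_two_pi_mul_nat hR]
      · rw [uFactorr_eq_div (Or.inl hr0), hdec, mul_add, ← add_assoc, Sxir_add_two_pi_mul_nat hR]
    rw [hL, hRt]

/-- One coordinate, symbols: `S_{R⁻¹}(y + 2πχ + 2πl) = S_{R⁻¹}(y + 2π((l+χ) mod R))`. [folklore] -/
theorem Sxir_shift {R : ℕ} (hR : R ≠ 0) (l χ : ℕ) (y : ℝ) :
    B4Strip.Sxir R (y + 2 * π * χ + 2 * π * l)
      = B4Strip.Sxir R (y + 2 * π * (((l + χ) % R : ℕ) : ℝ)) := by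
  set m : ℕ := l + χ with hm
  have hdec : ((m : ℕ) : ℝ) = ((m % R : ℕ) : ℝ) + ((R * (m / R) : ℕ) : ℝ) := by
    exact_mod_cast (Nat.mod_add_div m R).symm
  have : y + 2 * π * χ + 2 * π * l = y + 2 * π * (m : ℝ) := by rw [hm]; push_cast; ring
  rw [this, hdec, mul_add, ← add_assoc, Sxir_add_two_pi_mul_nat hR]

/-- **Periodicity of the rescaled composed symbol.**  Shifting the rescaled momentum by `2πχ_ν` in each
coordinate (`χ_ν ∈ ℕ`) does not change `composedInvResc c R M̃` — the inner alias sum is re-labelled by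
`l′ ↦ l′ + χ (mod R)` — provided no shifted coordinate meets the filled removable singularity
(`y_ν ≠ 0` and `y_ν + 2πχ_ν ≠ 0` whenever `χ_ν ≠ 0`). [cite: King1986, (4.12) p.671 (alias sums over
`l′ ∈ 2πL^kℤ^d / 2πL^{k+n}ℤ^d` are representative-independent)] -/
theorem composedInvResc_periodic (c : ℝ) {R : ℕ} [NeZero R] (Mt : ℝ) {y : Fin dd → ℝ}
    (χ : Fin dd → ℕ) (h : ∀ ν, χ ν = 0 ∨ (y ν ≠ 0 ∧ y ν + 2 * π * χ ν ≠ 0)) :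
    composedInvResc c R Mt (fun ν => y ν + 2 * π * χ ν) = composedInvResc c R Mt y := by
  have hR : R ≠ 0 := NeZero.ne R
  unfold composedInvResc
  congr 1
  -- re-label the inner aliases: `l′ ↦ l′ + χ (mod R)` coordinatewise
  let σ : (Fin dd → Fin R) ≃ (Fin dd → Fin R) :=
    Equiv.piCongrRight fun ν => Equiv.addRight (Fin.ofNat R (χ ν))
  have hval : ∀ (l'' : Fin dd → Fin R) (ν : Fin dd),
      ((σ l'' ν : Fin R) : ℕ) = ((l'' ν : ℕ) + χ ν) % R := by
    intro l'' ν
    simp [σ, Fin.val_add]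
  refine Fintype.sum_equiv σ _ _ fun l'' => ?_
  have hU : B4Strip.Ur R l'' (fun ν => y ν + 2 * π * χ ν) = B4Strip.Ur R (σ l'') y := by
    unfold B4Strip.Ur
    refine Finset.prod_congr rfl fun ν _ => ?_
    rw [hval l'' ν]
    exact uFactorr_shift hR (l'' ν).isLt (χ ν) (h ν)
  have hB : B4Strip.DeltaXir R Mt (B4Strip.shiftr R l'' (fun ν => y ν + 2 * π * χ ν))
      = B4Strip.DeltaXir R Mt (B4Strip.shiftr R (σ l'') y) := by
    unfold B4Strip.DeltaXir B4Strip.shiftr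
    congr 1
    refine Finset.sum_congr rfl fun ν _ => ?_
    rw [hval l'' ν]
    exact Sxir_shift hR (l'' ν) (χ ν) (y ν)
  rw [hU, hB]

/-- Which coordinates of the cell's alias representative `p′ + 2πl` (`l_μ ∈ {0,…,N−1}`) lie beyond King's
symmetric zone `|q_μ| ≤ πN` and must be pulled back by `2πN`. [folklore] -/
def symmShift (N : ℕ) (l : Fin dd → Fin N) (p : Fin dd → ℝ) : Fin dd → ℕ :=
  fun μ => if π * N < B4Strip.shiftr N l p μ then 1 else 0

/-- The symmetric representative `q̃` of the alias `p′ + 2πl`: `q̃_μ = p′_μ + 2πl_μ − 2πN·[p′_μ + 2πl_μ > πN]`.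
[cite: King1986, p.670 ("`−π(L^k−1) ≤ l_μ ≤ π(L^k−1)` for `L` odd, `−πL^k ≤ l_μ ≤ πL^k` for `L` even")] -/
def symmAlias (N : ℕ) (l : Fin dd → Fin N) (p : Fin dd → ℝ) : Fin dd → ℝ :=
  fun μ => B4Strip.shiftr N l p μ - 2 * π * N * symmShift N l p μ

/-- The pull-back count is `0` or `1`. [folklore] -/
theorem symmShift_le_one (N : ℕ) (l : Fin dd → Fin N) (p : Fin dd → ℝ) (μ : Fin dd) :
    symmShift N l p μ = 0 ∨ symmShift N l p μ = 1 := by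
  unfold symmShift; split_ifs <;> simp

/-- Range of the cell's alias representative: `−π ≤ p′_μ + 2πl_μ ≤ 2πN − π`. [folklore] -/
theorem shiftr_mem {N : ℕ} (l : Fin dd → Fin N) {p : Fin dd → ℝ} (hp : ∀ μ, |p μ| ≤ π)
    (μ : Fin dd) : -π ≤ B4Strip.shiftr N l p μ ∧ B4Strip.shiftr N l p μ ≤ 2 * π * N - π := by
  simp only [B4Strip.shiftr]
  have h1 := (abs_le.mp (hp μ)).1
  have h2 := (abs_le.mp (hp μ)).2
  have hl0 : (0 : ℝ) ≤ (l μ : ℕ) := by positivity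
  have hlN : ((l μ : ℕ) : ℝ) ≤ N - 1 := by
    have : ((l μ : ℕ) + 1 : ℕ) ≤ N := (l μ).isLt
    have : (((l μ : ℕ) + 1 : ℕ) : ℝ) ≤ N := by exact_mod_cast this
    push_cast at this; linarith
  constructor <;> nlinarith [Real.pi_pos]

/-- The symmetric representative lies in King's zone `|q̃_μ| ≤ πN`. [cite: King1986, (4.2) p.670] -/
theorem symmAlias_abs_le {N : ℕ} (hN : 1 ≤ N) (l : Fin dd → Fin N) {p : Fin dd → ℝ}
    (hp : ∀ μ, |p μ| ≤ π) (μ : Fin dd) : |symmAlias N l p μ| ≤ π * N := by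
  have hN1 : (1 : ℝ) ≤ N := by exact_mod_cast hN
  obtain ⟨h1, h2⟩ := shiftr_mem l hp μ
  unfold symmAlias symmShift
  split_ifs with hlt
  · push_cast; rw [abs_le]; constructor <;> nlinarith [Real.pi_pos]
  · push Not at hlt
    push_cast; rw [abs_le]; constructor <;> nlinarith [Real.pi_pos]

/-- `p′ ≠ 0 ⇒ q̃ ≠ 0` (the alias `l = 0` is `p′` itself; any alias `l ≠ 0` has a coordinate of modulus
`≥ π`). [folklore] -/
theorem symmAlias_momSq_pos {N : ℕ} (hN : 1 ≤ N) (l : Fin dd → Fin N) {p : Fin dd → ℝ}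
    (hp : ∀ μ, |p μ| ≤ π) (hp0 : 0 < momSq p) : 0 < momSq (symmAlias N l p) := by
  by_contra hneg
  have hzero : momSq (symmAlias N l p) = 0 := le_antisymm (not_lt.mp hneg) (momSq_nonneg _)
  have hall : ∀ μ, symmAlias N l p μ = 0 := by
    intro μ
    have h := (Finset.sum_eq_zero_iff_of_nonneg (fun ν _ => sq_nonneg (symmAlias N l p ν))).mp
      hzero μ (Finset.mem_univ μ)
    exact pow_eq_zero_iff (n := 2) (by norm_num) |>.mp h
  -- then every coordinate of `p′` vanishes
  have hp_zero : ∀ μ, p μ = 0 := by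
    intro μ
    have hN1 : (1 : ℝ) ≤ N := by exact_mod_cast hN
    obtain ⟨h1, h2⟩ := shiftr_mem l hp μ
    have h := hall μ
    unfold symmAlias symmShift at h
    split_ifs at h with hlt
    · exfalso; push_cast at h; nlinarith [Real.pi_pos]
    · push Not at hlt
      push_cast at h
      rw [mul_zero, sub_zero] at h
      -- `p_μ + 2πl_μ = 0` with `|p_μ| ≤ π` forces `l_μ = 0` and `p_μ = 0`
      simp only [B4Strip.shiftr] at h
      have hpμ := (abs_le.mp (hp μ)).1
      have hl0 : (l μ : ℕ) = 0 := by
        by_contra hl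
        have hl1 : (1 : ℝ) ≤ (l μ : ℕ) := by exact_mod_cast Nat.one_le_iff_ne_zero.mpr hl
        nlinarith [Real.pi_pos]
      rw [hl0] at h; push_cast at h; linarith
  have : momSq p = 0 := by unfold momSq; simp [hp_zero]
  linarith

/-- The `η`-lattice symbol does not see the pull-back: `Δ^η(q̃) = Δ^η(p′ + 2πl)` (`2πN`-periodicity of
`S_{N⁻¹}`). [cite: King1986, (4.4) p.670] -/
theorem DeltaXir_symmAlias {N : ℕ} (hN : N ≠ 0) (M : ℝ) (l : Fin dd → Fin N) (p : Fin dd → ℝ) :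
    B4Strip.DeltaXir N M (symmAlias N l p) = B4Strip.DeltaXir N M (B4Strip.shiftr N l p) := by
  unfold B4Strip.DeltaXir
  congr 1
  refine Finset.sum_congr rfl fun μ _ => ?_
  have : B4Strip.shiftr N l p μ = symmAlias N l p μ + 2 * π * ((N * symmShift N l p μ : ℕ) : ℝ) := by
    unfold symmAlias; push_cast; ring
  rw [this, Sxir_add_two_pi_mul_nat hN]

/-- The composed symbol does not see the pull-back either: `D⁻¹(q̃) = D⁻¹(p′ + 2πl)` — by
`composedInvResc_periodic`, the pulled-back coordinates `q̃_μ/N ∈ (−π, −π/N]` avoiding the two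
singular points. [cite: King1986, (4.12) p.671] -/
theorem composedInv_symmAlias (cn : ℝ) {N R : ℕ} (hN : 1 ≤ N) [NeZero R] (M : ℝ)
    (l : Fin dd → Fin N) {p : Fin dd → ℝ} (hp : ∀ μ, |p μ| ≤ π) :
    composedInv cn N R M (symmAlias N l p) = composedInv cn N R M (B4Strip.shiftr N l p) := by
  have hN0 : N ≠ 0 := by omega
  have hN' : (0 : ℝ) < N := by exact_mod_cast Nat.pos_of_ne_zero hN0
  unfold composedInv
  congr 1
  have hshift : (fun μ => B4Strip.shiftr N l p μ / (N : ℝ))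
      = fun μ => symmAlias N l p μ / N + 2 * π * (symmShift N l p μ : ℕ) := by
    funext μ; unfold symmAlias; field_simp; ring
  rw [hshift]
  symm
  refine composedInvResc_periodic (R := R) cn (M / (N : ℝ) ^ 2) (symmShift N l p) fun ν => ?_
  rcases symmShift_le_one N l p ν with h0 | h1
  · exact Or.inl h0
  · right
    obtain ⟨hlo, hhi⟩ := shiftr_mem l hp ν
    have hlt : π * N < B4Strip.shiftr N l p ν := by
      unfold symmShift at h1; split_ifs at h1 with hlt; exact hlt
    have hq : symmAlias N l p ν = B4Strip.shiftr N l p ν - 2 * π * N := by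
      unfold symmAlias; rw [h1]; push_cast; ring
    rw [h1, hq]
    push_cast
    constructor
    · have : B4Strip.shiftr N l p ν - 2 * π * N < 0 := by nlinarith [Real.pi_pos]
      exact (div_neg_of_neg_of_pos this hN').ne
    · rw [div_add' _ _ _ hN'.ne', div_ne_zero_iff]
      refine ⟨?_, hN'.ne'⟩
      have hN1 : (1 : ℝ) ≤ N := by exact_mod_cast hN
      nlinarith [Real.pi_pos]

/-! ## §4 King's level symbol (4.5) and Lemma 4.3 / Prop. 3.10 (3.91) for the symbols themselves -/

/-- **King's effective-Laplacian symbol (4.5)** at level `k`, in the cell's `B4Strip` vocabulary: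
`Δ^{(k)}(p′) = (a_k⁻¹ + Σ_l |u_k^η(p′+l)|² Δ^η(p′+l)⁻¹)⁻¹` with `N = L^k = η⁻¹`, `|u_k^η(p′+l)|² = Ur N l p′`,
`Δ^η(p′+l) = DeltaXir N M (p′ + 2πl)`, `a = a_k`; `= (composedInvResc a⁻¹ N M p′)⁻¹`.  (Alias
representatives `l_μ ∈ {0,…,N−1}`; the summands depend on the class of `l` mod `N` only.)
[cite: King1986, (4.3)–(4.5) p.670] -/
def DeltaEff (a : ℝ) (N : ℕ) (M : ℝ) (p : Fin dd → ℝ) : ℝ := (composedInvResc a⁻¹ N M p)⁻¹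

/-- (4.5) is an instance of the abstract `effSymbol` of `EffectiveLaplacianRate` (all aliases,
weights `Ur N l p′`, values `Δ^η(p′+2πl)`). [cite: King1986, (4.5) p.670] -/
theorem DeltaEff_eq_effSymbol (a : ℝ) (N : ℕ) (M : ℝ) (p : Fin dd → ℝ) :
    DeltaEff a N M p = effSymbol Finset.univ a (fun l => B4Strip.Ur N l p)
      (fun l => B4Strip.DeltaXir N M (B4Strip.shiftr N l p)) := rfl

/-- `0 < Δ^{(k)}(p′)` for `a > 0`, `M ≥ 0`, `p′ ≠ 0` in `[−π,π]^d`. [cite: King1986, p.671 ("`Δ^η` … positive")] -/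
theorem DeltaEff_pos {a : ℝ} (ha : 0 < a) {N : ℕ} (hN : 1 ≤ N) {M : ℝ} (hM : 0 ≤ M)
    {p : Fin dd → ℝ} (hp : ∀ μ, |p μ| ≤ π) (hp0 : 0 < momSq p) : 0 < DeltaEff a N M p := by
  haveI : NeZero N := ⟨by omega⟩
  unfold DeltaEff
  exact inv_pos.mpr (composedInvResc_pos (inv_pos.mpr ha).le hN hM hp hp0)

/-- "`Δ^{(k)}(p′) ≤ a_k`". [cite: King1986, proof of Lemma 4.1 p.671] -/
theorem DeltaEff_le {a : ℝ} (ha : 0 < a) (N : ℕ) {M : ℝ} (hM : 0 ≤ M) (p : Fin dd → ℝ) :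
    DeltaEff a N M p ≤ a := by
  unfold DeltaEff composedInvResc
  have hsum : 0 ≤ ∑ m : Fin dd → Fin N,
      B4Strip.Ur N m p * (B4Strip.DeltaXir N M (B4Strip.shiftr N m p))⁻¹ :=
    Finset.sum_nonneg fun m _ =>
      mul_nonneg (B4Strip.Ur_nonneg N m p) (inv_nonneg.mpr (B4Strip.DeltaXir_nonneg N M hM _))
  calc (a⁻¹ + ∑ m : Fin dd → Fin N,
        B4Strip.Ur N m p * (B4Strip.DeltaXir N M (B4Strip.shiftr N m p))⁻¹)⁻¹ ≤ (a⁻¹)⁻¹ :=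
        inv_anti₀ (inv_pos.mpr ha) (le_add_of_nonneg_right hsum)
    _ = a := inv_inv a

/-- **The composition law in symbol form**: with `a′⁻¹ = a⁻¹ + N⁻²a_n⁻¹` (`a = a_k`, `a′ = a_{k+n}`), the
level-`(k+n)` symbol (4.5) over `R·N = L^{k+n}` fine points EQUALS King's (4.6)
`Δ̄^{(k)}(p′) = (a_k⁻¹ + Σ_l |u_k^η(p′+l)|² D⁻¹(p′+l))⁻¹` with the composed `D` of (4.12).
[cite: King1986, (4.6) p.670, (4.12) p.671 ("the composition law for renormalization transformations
allows us to write `Δ^{(k+n)}(p′)` in the form (4.6)")] -/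
theorem DeltaEff_comp {N R : ℕ} (hN : 1 ≤ N) (hR : 1 ≤ R) {a an a' : ℝ}
    (ha' : a'⁻¹ = a⁻¹ + ((N : ℝ) ^ 2)⁻¹ * an⁻¹) (M : ℝ) {p : Fin dd → ℝ} (hp : ∀ μ, |p μ| ≤ π) :
    DeltaEff a' (R * N) M p = effSymbol Finset.univ a (fun l => B4Strip.Ur N l p)
      (fun l => (composedInv an⁻¹ N R M (B4Strip.shiftr N l p))⁻¹) := by
  unfold DeltaEff effSymbol
  rw [ha', composition_law hN hR _ _ _ hp]
  simp only [inv_inv]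

/-- **King's Lemma 4.3 (4.18) = Proposition 3.10 (3.91) for the level symbols themselves, explicit
constant, nothing assumed.**  For `0 < a` (`= a_k`), `0 < a_n`, `a′⁻¹ = a⁻¹ + N⁻²a_n⁻¹` (`= a_{k+n}⁻¹`),
`N ≥ 1` (`= L^k`), `R ≥ 1` (`= L^n`), `M ≥ 0`, `p′ ∈ [−π,π]^d`, `p′ ≠ 0`:
`|Δ^{(k)}(p′) − Δ^{(k+n)}(p′)| ≤ 2a(a_n⁻¹ + π²/48 + 1/3)·N⁻²·Δ^{(k)}(p′)`.
Proof = King's: Lemma 4.1 (`abs_effSymbol_sub_le_of_ref`) with (4.7) for `Δ^η`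
(`latticeSymbol_inv_sub_ref_le`) and for `D` (Lemma 4.2, `lemma42`) — both applied at the SYMMETRIC
representatives `q̃` of the aliases (§3), which changes neither `Δ^η` nor `D` — and the composition law
(`DeltaEff_comp`). [cite: King1986, Lemma 4.3 (4.18) p.672; Prop. 3.10 (3.91) p.669] -/
theorem lemma43 {a an a' M : ℝ} (ha : 0 < a) (han : 0 < an) {N R : ℕ} (hN : 1 ≤ N) [NeZero R]
    (hR : 1 ≤ R) (ha' : a'⁻¹ = a⁻¹ + ((N : ℝ) ^ 2)⁻¹ * an⁻¹) (hM : 0 ≤ M) {p : Fin dd → ℝ}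
    (hp : ∀ μ, |p μ| ≤ π) (hp0 : 0 < momSq p) :
    |DeltaEff a N M p - DeltaEff a' (R * N) M p|
      ≤ a * (2 * ((an⁻¹ + π ^ 2 / 48 + 1 / 3) * ((N : ℝ) ^ 2)⁻¹)) * DeltaEff a N M p := by
  have hN0 : N ≠ 0 := by omega
  -- King's argument at the symmetric representatives `q̃_l`
  have h := prop310_rate (s := Finset.univ) (M := M) (R := R) ha (inv_pos.mpr han).le hM hN hR
    (w := fun l => B4Strip.Ur N l p) (q := fun l => symmAlias N l p)
    (fun l _ => B4Strip.Ur_nonneg N l p) (sum_Ur_eq_one hN hp).le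
    (fun l _ μ => symmAlias_abs_le hN l hp μ) (fun l _ => symmAlias_momSq_pos hN l hp hp0)
  -- `Δ^η(q̃_l) = DeltaXir N M (p′+2πl)` and `D(q̃_l) = D(p′+2πl)`
  have hA : (fun l : Fin dd → Fin N => latticeSymbol ((N : ℝ)⁻¹) M (symmAlias N l p))
      = fun l => B4Strip.DeltaXir N M (B4Strip.shiftr N l p) := by
    funext l; rw [← DeltaXir_eq_latticeSymbol hN0, DeltaXir_symmAlias hN0]
  have hD : (fun l : Fin dd → Fin N => (composedInv an⁻¹ N R M (symmAlias N l p))⁻¹)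
      = fun l => (composedInv an⁻¹ N R M (B4Strip.shiftr N l p))⁻¹ := by
    funext l; rw [composedInv_symmAlias an⁻¹ hN M l hp]
  rw [hA, hD, ← DeltaEff_eq_effSymbol, ← DeltaEff_comp hN hR ha' M hp] at h
  exact h

/-- **Lemma 4.3 / (3.91) with King's constants**: `a_k = aK a L k` ((2.13) p.653), `N = L^k`, `R = L^n`,
`a_{k+n}⁻¹ = a_k⁻¹ + L^{−2k}a_n⁻¹` (`inv_aK_add`): for `L ≥ 2`, `k, n ≥ 1`, `a > 0`, `M ≥ 0`, `p′ ≠ 0` in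
`[−π,π]^d`, `|Δ^{(k)}(p′) − Δ^{(k+n)}(p′)| ≤ 2a_k(a_n⁻¹ + π²/48 + 1/3)·L^{−2k}·Δ^{(k)}(p′)` — "`≤ CL^{−2k}Δ^{(k)}(p′)`"
uniformly in `n`, `d`, `M`, `p′`. [cite: King1986, Lemma 4.3 (4.18) p.672; Prop. 3.10 (3.91) p.669] -/
theorem lemma43_aK {a : ℝ} (ha : 0 < a) {L k n : ℕ} (hL : 2 ≤ L) (hk : 1 ≤ k) (hn : 1 ≤ n)
    {M : ℝ} (hM : 0 ≤ M) {p : Fin dd → ℝ} (hp : ∀ μ, |p μ| ≤ π) (hp0 : 0 < momSq p) :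
    |DeltaEff (aK a L k) (L ^ k) M p - DeltaEff (aK a L (k + n)) (L ^ n * L ^ k) M p|
      ≤ aK a L k * (2 * (((aK a L n)⁻¹ + π ^ 2 / 48 + 1 / 3) * (((L ^ k : ℕ) : ℝ) ^ 2)⁻¹))
        * DeltaEff (aK a L k) (L ^ k) M p := by
  have hL1 : (1 : ℝ) < L := by exact_mod_cast hL
  have hL0 : L ≠ 0 := by omega
  haveI : NeZero (L ^ n) := ⟨pow_ne_zero n hL0⟩
  have hN : 1 ≤ L ^ k := Nat.one_le_pow k L (by omega)
  have hR : 1 ≤ L ^ n := Nat.one_le_pow n L (by omega)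
  have ha' : (aK a L (k + n))⁻¹ = (aK a L k)⁻¹ + ((((L ^ k : ℕ) : ℝ)) ^ 2)⁻¹ * (aK a L n)⁻¹ := by
    rw [inv_aK_add ha hL1 k n]
    push_cast
    rw [← pow_mul, mul_comm k 2]
  exact lemma43 (aK_pos ha hL1 hk) (aK_pos ha hL1 hn) hN hR ha' hM hp hp0

end Literature.MathematicalPhysics.QuantumFieldTheory.King1986

end
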